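import Mathlib
import Summits.NavierStokesRegularity.FluidComputer.AbcInertiaCIEigenvalues
import Literature.Analysis.OperatorTheory.BandedFirstOrderEigenvectorRegularity

/-!
# INERTIA-3L instantiation — CLASS I twin (instab3 g8; cert-3 g9's `AbcClassI` layer; character-free lemmas
# reused from the class-II files `AbcInertia*`). Part 10: FORM-DOMAIN eigenvectors are rapidly decaying — the count holds for
# the point spectrum of the class-II operator on its form domain (instab3 g8, cell `ns-blowup`, 2026-08-27)

HONEST FRAMING (human ruling D-0035): nothing here is a claim about Navier–Stokes blow-up.
WHAT THIS IS NOT: not NS evidence. MODEL lane (forced-ABC linearisation, class II, coordinates of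
`AbcClassIIDefs`); no certificate, number or census word moves.

`AbcInertiaEigenvalues.card_eigenpairs_le` counts RAPIDLY DECAYING coordinate eigenvectors. By the
Literature bootstrap `FirstOrderBand.summable_weighted_of_eigen` (interior elliptic regularity in Fourier
coefficients, Evans §6.3.1; instab4's X0 chain uses the same lemma), every coordinate eigenvector of the
class-II operator `(L x)_i = −(|O_i|²/R) x_i + Σ_{j ∈ AbcClassI.nbrIdx i} AbcClassI.amat i j x_j` (`R ≥ 1`) lying in the FORM
DOMAIN `Σ (1 + |O_i|²)|x_i|² < ∞` is rapidly decaying (`rapid_of_formDomain_eigen`: band `AbcClassI.nbrIdx` of width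
`≤ 288²`, symmetric; growth `|AbcClassI.amat i j| ≤ 2592 √(1+|O_j|²) ≤ 2592√R · w_j` with `w_j = √(1 + |O_j|²/R)`;
comparable weights `AbcClassIIIndex.one_add_onormSq_le_of_mem_nbrIdx`; Hilbert basis = the coordinate
basis of `ℓ²(AbcClassI.Idx, ℂ)`). Hence **`card_formDomain_eigenpairs_le`**: given the INERTIA-3L count `hcount` of a
cell `(R, a, m)`, `n` form-domain eigenvectors with pairwise distinct eigenvalues of real part `≥ a` ⇒
`n ≤ m` — the count is a statement about the POINT SPECTRUM of the class-II operator (domain `H² ⊂` form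
domain `H¹`), not only about smooth eigenfunctions.

Mathlib + `AbcInertiaEigenvalues` + `Literature…BandedFirstOrderEigenvectorRegularity`; no new definitions;
std axioms. [folklore]
-/

noncomputable section

open scoped BigOperators ComplexConjugate InnerProductSpace lp
open Finset

namespace Summit.NavierStokesRegularity.FluidComputer.AbcInertiaCI

open Literature.Analysis.FunctionSpaces Literature.Analysis.FunctionSpaces.Torus
open Literature.Analysis.FluidPDE
open Summit.NavierStokesRegularity.FluidComputer.AbcClassI
open Summit.NavierStokesRegularity.FluidComputer.AbcClassII (Fam crossForm secOp rotR rotS sgnAct sgnOrbit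
  cube extend restrictTo extend_add extend_smul extend_zero rotR_add rotR_smul rotS_add rotS_smul
  crossForm_add crossForm_smul secOp_add secOp_smul restrictTo_add restrictTo_smul Orbit toOrbit onormSq
  osupNorm cubeOrbits nbrOrbits mem_sgnOrbit mem_sgnOrbit_self card_sgnOrbit_le sgnOrbit_eq_of_mem
  mem_sgnOrbit_comm sgnOrbit_eq_or_disjoint neg_mem_sgnOrbit neg_self_mem_sgnOrbit rotFreqR_mem_sgnOrbit
  rotFreqS_mem_sgnOrbit freqNormSq_eq_of_mem_sgnOrbit supNorm_eq_of_mem_sgnOrbit mem_cube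
  mem_cube_iff_supNorm cube_mono sgnOrbit_subset_cube zero_not_mem_sgnOrbit ne_zero_of_mem_sgnOrbit
  toOrbit_val toOrbit_eq_iff mem_cubeOrbits mem_nbrOrbits mem_nbrOrbits_comm card_nbrOrbits_le rotR_apply
  rotS_apply freqNormSq_rotFreq secOp_conj isConjSymm_secOp kdot_secOp mem_iff_of_orbitClosed
  isConjSymm_cut kdot_cut orbitClosed_cube_ne_zero orbitClosed_shell neg_mem_of_orbitClosed
  isConjSymm_lerayCrossForm kdot_conj conj_eq_zero_of_not_mem linOp_zero_eq conj_theta_neg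
  extend_apply_of_mem extend_apply_of_not_mem restrictTo_extend extend_restrictTo extend_sum
  inner_eq_sum_extend inner_conjVec_conjVec conj_sum_inner_of_isConjSymm sum_inner_eq_re_of_isConjSymm
  real_inner_eq_re real_smul_eq norm_lerayCrossForm_le sobolevWeight_one_eq cube_filter_eq_biUnion sum_cube_filter_eq
  onormSq_nonneg)

/-- **Form-domain eigenvectors of the class-II coordinate operator are rapidly decaying** (`R ≥ 1`). -/
theorem rapid_of_formDomain_eigen {R : ℝ} (hR : 1 ≤ R) (μ : ℂ) {x : AbcClassI.Idx → ℂ}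
    (hx1 : Summable fun i : AbcClassI.Idx => (1 + onormSq i.1) * ‖x i‖ ^ 2)
    (heig : ∀ i : AbcClassI.Idx, ((-(onormSq i.1 / R) : ℝ) : ℂ) * x i + ∑ j ∈ AbcClassI.nbrIdx i, ((AbcClassI.amat i j : ℝ) : ℂ) * x j =
      μ * x i) (s : ℕ) :
    Summable fun i : AbcClassI.Idx => (1 + onormSq i.1) ^ s * ‖x i‖ ^ 2 := by
  classical
  have hR0 : 0 < R := by linarith
  -- the coordinate vector as an element of ℓ² and the coordinate Hilbert basis
  have hx0 : Summable fun i : AbcClassI.Idx => ‖x i‖ ^ 2 := summable_norm_sq_of_weighted hx1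
  set f : ℓ²(AbcClassI.Idx, ℂ) := ⟨x, memℓp_two_of_summable_sq hx0⟩ with hf
  set b : HilbertBasis AbcClassI.Idx ℂ ℓ²(AbcClassI.Idx, ℂ) := HilbertBasis.ofRepr (LinearIsometryEquiv.refl ℂ ℓ²(AbcClassI.Idx, ℂ)) with hb
  have hcoef : ∀ i : AbcClassI.Idx, ⟪b i, f⟫_ℂ = x i := by
    intro i
    rw [← b.repr_apply_apply]
    rfl
  -- weights, levels, growth constants
  set w : AbcClassI.Idx → ℝ := fun i => Real.sqrt (1 + onormSq i.1 / R) with hw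
  set ℓ : AbcClassI.Idx → ℝ := fun i => -(onormSq i.1 / R) with hℓ
  have hq : ∀ i : AbcClassI.Idx, 0 ≤ onormSq i.1 / R := fun i => div_nonneg (onormSq_nonneg i.1) hR0.le
  have hw0 : ∀ i, 0 ≤ w i := fun i => Real.sqrt_nonneg _
  have hwsq : ∀ i, w i ^ 2 = 1 + onormSq i.1 / R := fun i => Real.sq_sqrt (by linarith [hq i])
  have hwℓ : ∀ i, w i ^ 2 ≤ 1 + |ℓ i| := by
    intro i; rw [hwsq, hℓ]; simp only [abs_neg, abs_of_nonneg (hq i)]; exact le_rfl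
  -- growth: `|AbcClassI.amat i j| ≤ 2592 √R · w_j`
  have hgrowth : ∀ i j : AbcClassI.Idx, j ∈ AbcClassI.nbrIdx i → ‖((AbcClassI.amat i j : ℝ) : ℂ)‖ ≤ 2592 * Real.sqrt R * w j := by
    intro i j _
    rw [Complex.norm_real, Real.norm_eq_abs]
    refine (abs_amat_le i j).trans ?_
    have h1 : Real.sqrt (1 + onormSq j.1) ≤ Real.sqrt R * w j := by
      rw [hw, ← Real.sqrt_mul hR0.le]
      refine Real.sqrt_le_sqrt ?_
      have := onormSq_nonneg j.1
      have e : R * (1 + onormSq j.1 / R) = R + onormSq j.1 := by field_simp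
      rw [e]; linarith
    nlinarith [Real.sqrt_nonneg (1 + onormSq j.1)]
  -- comparable weights along the band
  have hL : ∀ i j : AbcClassI.Idx, j ∈ AbcClassI.nbrIdx i → w i ≤ Real.sqrt (2 * (1 + R⁻¹)) * w j := by
    intro i j hij
    rw [hw, ← Real.sqrt_mul (by positivity)]
    exact Real.sqrt_le_sqrt (one_add_onormSq_le_of_mem_nbrIdx hR0 hij)
  -- the eigen-equation in the Hilbert-basis coordinates
  have heig' : ∀ i : AbcClassI.Idx, (ℓ i : ℂ) * ⟪b i, f⟫_ℂ + ∑ j ∈ AbcClassI.nbrIdx i, ((AbcClassI.amat i j : ℝ) : ℂ) * ⟪b j, f⟫_ℂ =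
      μ * ⟪b i, f⟫_ℂ := by
    intro i
    simp only [hcoef]
    exact heig i
  -- the form-level energy
  have h1 : Summable fun i : AbcClassI.Idx => w i ^ 2 * ‖⟪b i, f⟫_ℂ‖ ^ 2 := by
    refine Summable.of_nonneg_of_le (fun i => mul_nonneg (sq_nonneg _) (sq_nonneg _)) (fun i => ?_) hx1
    rw [hcoef, hwsq]
    have : onormSq i.1 / R ≤ onormSq i.1 := div_le_self (onormSq_nonneg i.1) hR
    exact mul_le_mul_of_nonneg_right (by linarith) (sq_nonneg _)
  -- the bootstrap
  have hboot := Literature.Analysis.OperatorTheory.FirstOrderBand.summable_weighted_of_eigen (e := b)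
    (w := w) (ℓ := ℓ) (nbr := AbcClassI.nbrIdx) (a := fun i j => ((AbcClassI.amat i j : ℝ) : ℂ)) (K := 2592 * Real.sqrt R)
    (L := Real.sqrt (2 * (1 + R⁻¹))) (W := 288 * 288) (f := f) (lam := μ)
    hw0 hwℓ (by positivity) hgrowth (fun i j => mem_nbrIdx_comm i j) (fun i => card_nbrIdx_le i)
    (Real.sqrt_nonneg _) hL heig' h1 s
  -- back to the weights `(1 + |O|²)^s ≤ R^s (1 + |O|²/R)^s`
  refine Summable.of_nonneg_of_le (fun i => mul_nonneg (pow_nonneg (by linarith [onormSq_nonneg i.1]) _)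
    (sq_nonneg _)) (fun i => ?_) (hboot.mul_left (R ^ s))
  rw [hcoef, pow_mul, hwsq, ← mul_assoc, ← mul_pow]
  refine mul_le_mul_of_nonneg_right (pow_le_pow_left₀ (by linarith [onormSq_nonneg i.1]) ?_ s) (sq_nonneg _)
  have e : R * (1 + onormSq i.1 / R) = R + onormSq i.1 := by field_simp
  rw [e]; linarith

/-- **The count on the form domain.** Given the INERTIA-3L count `hcount` for the cell `(R, a, m)`
(`R ≥ 1`): `n` coordinate eigenvectors in the form domain `Σ(1+|O_i|²)|x_i|² < ∞` with pairwise distinct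
eigenvalues of real part `≥ a` ⇒ `n ≤ m`. -/
theorem card_formDomain_eigenpairs_le {R a : ℝ} {m : ℕ} (hR : 1 ≤ R)
    (hcount : ∀ (W : Submodule ℂ (AbcClassI.Idx → ℂ)), FiniteDimensional ℂ W →
      (∀ x ∈ W, ∀ s : ℕ, Summable fun i : AbcClassI.Idx => (1 + onormSq i.1) ^ s * ‖x i‖ ^ 2) →
      (∀ x ∈ W, (fun i : AbcClassI.Idx => ((-(onormSq i.1 / R) : ℝ) : ℂ) * x i +
        ∑ j ∈ AbcClassI.nbrIdx i, ((AbcClassI.amat i j : ℝ) : ℂ) * x j) ∈ W) →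
      (∀ (μ : ℂ) (x : AbcClassI.Idx → ℂ), x ∈ W → x ≠ 0 →
        (∀ i : AbcClassI.Idx, ((-(onormSq i.1 / R) : ℝ) : ℂ) * x i + ∑ j ∈ AbcClassI.nbrIdx i, ((AbcClassI.amat i j : ℝ) : ℂ) * x j = μ * x i) →
        a ≤ μ.re) →
      Module.finrank ℂ W ≤ m)
    {n : ℕ} (μ : Fin n → ℂ) (hμ : Function.Injective μ) (x : Fin n → (AbcClassI.Idx → ℂ))
    (hx1 : ∀ k : Fin n, Summable fun i : AbcClassI.Idx => (1 + onormSq i.1) * ‖x k i‖ ^ 2)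
    (hx0 : ∀ k, x k ≠ 0)
    (heig : ∀ (k : Fin n) (i : AbcClassI.Idx), ((-(onormSq i.1 / R) : ℝ) : ℂ) * x k i +
      ∑ j ∈ AbcClassI.nbrIdx i, ((AbcClassI.amat i j : ℝ) : ℂ) * x k j = μ k * x k i)
    (hre : ∀ k, a ≤ (μ k).re) : n ≤ m :=
  card_eigenpairs_le hcount μ hμ x (fun k s => rapid_of_formDomain_eigen hR (μ k) (hx1 k) (heig k) s)
    hx0 heig hre

end Summit.NavierStokesRegularity.FluidComputer.AbcInertiaCI

end
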